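/-
Origin: expansion seat `planner-pub-hodgecm-pv01-0`, handover 2026-08-18T03:38:05Z (`HOME/pub-hodgecm-pv01/lean/Pv01/CircleCharacters.lean`, md5 b74ce21b, 217 lines);
landed by the gen-5 packager in gate run 19 as `HodgeCM/PerL34/CircleCharacters.lean` (verbatim).
-/
/-
Origin: HOME/pub-hodgecm-pv01/lean/Pv01/CircleCharacters.lean (module `Pv01.CircleCharacters`; the packager renames to
`HodgeCM.PerL34.CircleCharacters`) — session planner-pub-hodgecm-pv01-0 (unit pub-hodgecm-pv01, DAG-NODE PROVER #01).
DAG node (HOME/LEMMAS.md v2 §1): N26 (PerL v5 §4.1 opening paragraph, tex ll. 472–478) — the KERNEL part: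
"`\U(W_{i,b})=\U(1)` acts on it by a character `u\mapsto u^{-e_b(\Psi_i)}`, which \emph{defines} `e_b(\Psi_i)\in\Z`"
(l. 476) is a definition BECAUSE every continuous character of `U(1)` is `u ↦ u^n` for a unique integer `n`.
Pure Mathlib; no cited facts; nothing is assumed.
-/
import Mathlib

set_option autoImplicit false

/-!
# Continuous characters of `U(1)`

Main results (pure Mathlib, nothing assumed):

* `CircleChar.eq_zpow` : a continuous group homomorphism `χ : Circle →* Circle` is `z ↦ z ^ n` for some `n : ℤ`;
* `CircleChar.zpow_injective'` : the exponent is unique;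
* `CircleChar.existsUnique_zpow` : packaged `∃! n : ℤ, ∀ z, χ z = z ^ n`;
* `CircleChar.norm_eq_one` : a continuous multiplicative character `χ : Circle →* ℂ` is automatically unitary;
* `CircleChar.existsUnique_zpow_complex` : hence `∃! n : ℤ, ∀ z, χ z = (z : ℂ) ^ n`;
* `CircleChar.existsUnique_lineExponent` : a continuous action of `U(1)` on a complex normed space stabilising the
  line through a non-zero vector `φ⁰` acts on it by `u ↦ u^{-e}` for a UNIQUE `e : ℤ` — PerL v5 l. 476
  "which defines `e_b(\Psi_i)\in\Z`".

Method: lift `t ↦ χ (exp (i t))` through the covering map `Circle.exp : ℝ → U(1)`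
(`IsCoveringMap.existsUnique_continuousMap_lifts`; `ℝ` is simply connected and locally path connected), show the
lift is additive by uniqueness of lifts, hence real-linear (`map_real_smul`), and read off the integer from
`exp (F (2π)) = 1`.
-/

noncomputable section

open Complex

namespace HodgeCM
namespace PerL34
namespace CircleChar

/-- The pulled-back one-parameter map `t ↦ χ (exp (i t))`. -/
def pull (χ : Circle →* Circle) (hχ : Continuous χ) : C(ℝ, Circle) :=
  ⟨fun t => χ (Circle.exp t), hχ.comp Circle.exp.continuous⟩

/-- (Ported verbatim from the HodgeCMPerL package; no docstring in the source.) -/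
@[simp] theorem pull_apply (χ : Circle →* Circle) (hχ : Continuous χ) (t : ℝ) :
    pull χ hχ t = χ (Circle.exp t) := rfl

/-- A continuous lift of `t ↦ χ (exp (i t))` through `Circle.exp`, normalised by `F 0 = 0`, exists and is unique. -/
theorem existsUnique_lift (χ : Circle →* Circle) (hχ : Continuous χ) :
    ∃! F : C(ℝ, ℝ), F 0 = 0 ∧ Circle.exp ∘ F = pull χ hχ :=
  Circle.isCoveringMap_exp.existsUnique_continuousMap_lifts (pull χ hχ) 0 0 (by simp)

/-- The normalised lift is additive (uniqueness of lifts applied to `t ↦ F (s + t) - F s`). -/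
theorem lift_add (χ : Circle →* Circle) (hχ : Continuous χ) (F : C(ℝ, ℝ))
    (hF : Circle.exp ∘ F = pull χ hχ)
    (huniq : ∀ G : C(ℝ, ℝ), G 0 = 0 ∧ Circle.exp ∘ G = pull χ hχ → G = F) (s t : ℝ) :
    F (s + t) = F s + F t := by
  have hFt : ∀ r, Circle.exp (F r) = χ (Circle.exp r) := fun r => congrFun hF r
  let G : C(ℝ, ℝ) := ⟨fun r => F (s + r) - F s, by fun_prop⟩
  have hG0 : G 0 = 0 := by simp [G]
  have hG : Circle.exp ∘ G = pull χ hχ := by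
    funext r
    simp only [Function.comp_apply, G, ContinuousMap.coe_mk, Circle.exp_sub, hFt, Circle.exp_add, map_mul,
      pull_apply]
    rw [mul_comm, mul_div_assoc, div_self', mul_one]
  have hGF : G = F := huniq G ⟨hG0, hG⟩
  have := congrFun (congrArg DFunLike.coe hGF) t
  simp only [G, ContinuousMap.coe_mk] at this
  linarith

/-- **Every continuous endomorphism of `U(1)` is a power map.** -/
theorem eq_zpow (χ : Circle →* Circle) (hχ : Continuous χ) : ∃ n : ℤ, ∀ z : Circle, χ z = z ^ n := by
  obtain ⟨F, ⟨hF0, hF⟩, huniq⟩ := existsUnique_lift χ hχ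
  have hFt : ∀ r, Circle.exp (F r) = χ (Circle.exp r) := fun r => congrFun hF r
  have hadd : ∀ s t, F (s + t) = F s + F t :=
    lift_add χ hχ F hF (fun G hG => huniq G hG)
  -- `F` is a continuous additive map `ℝ → ℝ`, hence real-linear
  let Fh : ℝ →+ ℝ := { toFun := F, map_zero' := hF0, map_add' := hadd }
  have hlin : ∀ t : ℝ, F t = t * F 1 := by
    intro t
    have h := map_real_smul Fh F.continuous t (1 : ℝ)
    simpa [Fh, smul_eq_mul] using h
  -- the period forces an integer slope
  have h2π : Circle.exp (F (2 * Real.pi)) = 1 := by rw [hFt, Circle.exp_two_pi, map_one]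
  obtain ⟨n, hn⟩ := Circle.exp_eq_one.mp h2π
  have hslope : F 1 = n := by
    have h := hlin (2 * Real.pi)
    rw [hn] at h
    have hπ : (2 * Real.pi) ≠ 0 := by positivity
    field_simp at h
    linarith
  refine ⟨n, fun z => ?_⟩
  obtain ⟨t, rfl⟩ := Circle.exp_surjective z
  rw [← hFt, hlin, hslope, mul_comm, Circle.exp_intCast_mul]

/-- The exponent of a power map on `U(1)` is determined by the map. -/
theorem zpow_injective' {n m : ℤ} (h : ∀ z : Circle, z ^ n = z ^ m) : n = m := by
  by_contra hne
  have hd : (n - m : ℤ) ≠ 0 := sub_ne_zero.mpr hne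
  have hd' : ((n - m : ℤ) : ℝ) ≠ 0 := by exact_mod_cast hd
  have h1 : ∀ z : Circle, z ^ (n - m) = 1 := fun z => by rw [zpow_sub, h z, mul_inv_cancel]
  have h2 := h1 (Circle.exp (Real.pi / ((n - m : ℤ) : ℝ)))
  rw [← Circle.exp_intCast_mul] at h2
  have h3 : ((n - m : ℤ) : ℝ) * (Real.pi / ((n - m : ℤ) : ℝ)) = Real.pi := by field_simp
  rw [h3] at h2
  exact Circle.exp_pi_ne_one h2

/-- **Classification of continuous characters of `U(1)`**: `∃! n : ℤ, χ = (· ^ n)`. -/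
theorem existsUnique_zpow (χ : Circle →* Circle) (hχ : Continuous χ) :
    ∃! n : ℤ, ∀ z : Circle, χ z = z ^ n := by
  obtain ⟨n, hn⟩ := eq_zpow χ hχ
  exact ⟨n, hn, fun m hm => zpow_injective' fun z => (hm z).symm.trans (hn z)⟩

/-- A continuous multiplicative character `U(1) → ℂ` never vanishes. -/
theorem ne_zero (χ : Circle →* ℂ) (z : Circle) : χ z ≠ 0 := by
  intro h
  have h1 := χ.map_mul z z⁻¹
  rw [mul_inv_cancel, map_one, h, zero_mul] at h1
  exact one_ne_zero h1

/-- A continuous multiplicative character `U(1) → ℂ` is **unitary** (the image of the compact group is a bounded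
subgroup of `ℂˣ`). -/
theorem norm_eq_one (χ : Circle →* ℂ) (hχ : Continuous χ) (z : Circle) : ‖χ z‖ = 1 := by
  obtain ⟨M, hM⟩ := (isCompact_range hχ).isBounded.exists_norm_le
  have hbd : ∀ w : Circle, ‖χ w‖ ≤ M := fun w => hM _ ⟨w, rfl⟩
  have key : ∀ w : Circle, ¬ 1 < ‖χ w‖ := by
    intro w hw
    obtain ⟨k, hk⟩ := pow_unbounded_of_one_lt M hw
    have := hbd (w ^ k)
    rw [map_pow, norm_pow] at this
    exact absurd (lt_of_lt_of_le hk this) (lt_irrefl _)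
  rcases lt_trichotomy ‖χ z‖ 1 with h | h | h
  · exfalso
    refine key z⁻¹ ?_
    rw [map_inv, norm_inv]
    exact (one_lt_inv₀ (norm_pos_iff.mpr (ne_zero χ z))).mpr h
  · exact h
  · exact absurd h (key z)

/-- Codomain restriction of a continuous character `U(1) → ℂ` to `U(1) → U(1)`. -/
def toCircleHom (χ : Circle →* ℂ) (hχ : Continuous χ) : Circle →* Circle where
  toFun z := ⟨χ z, mem_sphere_zero_iff_norm.mpr (norm_eq_one χ hχ z)⟩
  map_one' := Circle.ext (by simp)
  map_mul' a b := Circle.ext (by simp)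

/-- (Ported verbatim from the HodgeCMPerL package; no docstring in the source.) -/
@[simp] theorem coe_toCircleHom (χ : Circle →* ℂ) (hχ : Continuous χ) (z : Circle) :
    ((toCircleHom χ hχ z : Circle) : ℂ) = χ z := rfl

/-- (Ported verbatim from the HodgeCMPerL package; no docstring in the source.) -/
theorem continuous_toCircleHom (χ : Circle →* ℂ) (hχ : Continuous χ) : Continuous (toCircleHom χ hχ) :=
  Continuous.subtype_mk hχ _

/-- **Classification of continuous characters `U(1) → ℂ`**: `∃! n : ℤ, χ z = z ^ n`. -/
theorem existsUnique_zpow_complex (χ : Circle →* ℂ) (hχ : Continuous χ) :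
    ∃! n : ℤ, ∀ z : Circle, χ z = (z : ℂ) ^ n := by
  obtain ⟨n, hn, huniq⟩ := existsUnique_zpow (toCircleHom χ hχ) (continuous_toCircleHom χ hχ)
  refine ⟨n, fun z => ?_, fun m hm => huniq m fun z => Circle.ext ?_⟩
  · have := congrArg (fun w : Circle => (w : ℂ)) (hn z)
    simpa using this
  · simpa using hm z

section Line

variable {V : Type*} [NormedAddCommGroup V] [NormedSpace ℂ V]

/-- The scalar by which an operator stabilising the line `ℂ φ⁰` acts on `φ⁰`. -/
theorem existsUnique_scalar {φ : V} (hφ : φ ≠ 0) {w : V} (hw : ∃ a : ℂ, w = a • φ) :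
    ∃! a : ℂ, w = a • φ := by
  obtain ⟨a, rfl⟩ := hw
  exact ⟨a, rfl, fun b hb => (smul_left_injective ℂ hφ hb).symm⟩

/-- **PerL v5 l. 476, "which defines `e_b(\Psi_i)\in\Z`"**: let `U(1)` act continuously and multiplicatively on a
complex normed space `V` by continuous linear maps `ρ u`, stabilising the line through a non-zero vector `φ⁰`.
Then there is a UNIQUE integer `e` with `ρ u φ⁰ = u^{-e} φ⁰` for all `u ∈ U(1)`. -/
theorem existsUnique_lineExponent (ρ : Circle →* (V →L[ℂ] V)) (φ : V) (hφ : φ ≠ 0)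
    (hline : ∀ u : Circle, ∃ a : ℂ, ρ u φ = a • φ) (hcont : Continuous fun u : Circle => ρ u φ) :
    ∃! e : ℤ, ∀ u : Circle, ρ u φ = ((u : ℂ) ^ (-e)) • φ := by
  classical
  -- the scalar character
  choose c hc using hline
  have hc1 : c 1 = 1 := by
    have h : (1 : ℂ) • φ = c 1 • φ := by
      rw [one_smul, ← hc 1, map_one]; rfl
    exact (smul_left_injective ℂ hφ h).symm
  have hcmul : ∀ u v, c (u * v) = c u * c v := by
    intro u v
    have h := hc (u * v)
    rw [map_mul] at h
    change (ρ u) ((ρ v) φ) = c (u * v) • φ at h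
    rw [hc v, map_smul, hc u, smul_smul, mul_comm (c v) (c u)] at h
    exact (smul_left_injective ℂ hφ h).symm
  let χ : Circle →* ℂ := { toFun := c, map_one' := hc1, map_mul' := hcmul }
  -- continuity of the scalar: `a ↦ a • φ` is a closed embedding `ℂ → V`
  let L : ℂ →ₗ[ℂ] V := LinearMap.toSpanSingleton ℂ V φ
  have hL : Topology.IsClosedEmbedding L :=
    LinearMap.isClosedEmbedding_of_injective (LinearMap.ker_toSpanSingleton ℂ hφ)
  have hχc : Continuous χ := by
    have : (fun u : Circle => ρ u φ) = L ∘ c := by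
      funext u; simp [L, hc u]
    rw [this] at hcont
    exact hL.isInducing.continuous_iff.mpr hcont
  obtain ⟨n, hn, huniq⟩ := existsUnique_zpow_complex χ hχc
  refine ⟨-n, fun u => ?_, fun e he => ?_⟩
  · rw [neg_neg, hc u]
    exact congrArg (· • φ) (hn u)
  · have h1 : -e = n := huniq (-e) fun u => by
      have h := he u
      rw [hc u] at h
      exact smul_left_injective ℂ hφ h
    omega

end Line

end CircleChar
end PerL34
end HodgeCM

end
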